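import Mathlib
import HarnessLib
import HarnessLib.Audit
import Summits.CriticalPhenomena.Statement
import Summits.CriticalPhenomena.Ising3DConformalLimit.Theorems.HyperoctahedralRPExistsScaleCovariantLimitSplitGlue
import HarnessLib.Audit.Status.Attr

/-!
Route: ModularBoosts

DORMANT since 2026-08-29T19:31:26Z (census g0: costume|duplicate of route-CriticalPhenomena-HyperoctahedralRP; reader census-reader-35-g0) — unstaffed, not closed; items shared with open routes are served there. `ledger route dormant <id> --off` reactivates.

# Route ModularBoosts — rotations are boosts — light cone from nine-mirror RP, SO(3) from wedge
modular covariance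

It suffices to show X_MB := (L) ∧ (M) ∧ (V) ∧ (B₃) ∧ (C) ∧ (D) ∧ (E), realising card
rotations-are-boosts-modular. Coordinates: index 2
of ℝ³ is the Euclidean time of the Osterwalder–Schrader reconstruction along e₃; "speed v" means
fields commute at spatial distance > v·|real time|.
(L) LIGHT CONE: every normalised (S = 0 off NonCoincident), non-degenerate, translation-invariant,
scale-covariant pointwise scaling limit S of
criticalCorr 3 has, for SOME v > 0, (a) causal slit-gluing — moving one insertion in complex e₃-time
ζ inside a slab free of other insertion
times, S continues holomorphically to {|Re ζ| < R} minus the cuts {Re ζ = 0, |Im ζ| ≥ ‖q‖/v} (q =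
spatial offset to its partner): the conclusion of
Glimm–Jaffe Prop. 19.5.7, which they prove FROM rotations — and (b) the spectral cone in the lattice
directions — joint holomorphy in (time
gap ζ, complex spatial shift β along e₀ or e₁) of a time-separated block on {Re ζ > −g, |Im β| <
v(Re ζ + g)}, i.e. H ≥ v|P_j| (Glimm–Jaffe
Cor. 19.5.4/Thm 19.5.5, again proved there from rotations). (M) MODULAR ENGINE: (a)+(b) at one v ⇒
for some c > 0 all S_n are invariant
under the orthogonal group of x₀² + x₁² + c²x₂². (V) SPEED LEMMA: such ellipsoidal isotropy + the
lattice swap x₀ ↔ x₂ + scale covariance +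
positivity ⇒ O(3). (B₃) axis permutations pass to limits. (C) existence of a scale-covariant limit
WITHOUT rotations, (D) the normalised
inversion upgrade, (E) U₄ ≢ 0 — the three items shared verbatim with route HyperoctahedralRP
(stmt-1981, -1982, -0636).
Lean: `IsingLimitLightCone ∧ ModularBoostIsotropy ∧ EllipsoidToSphere ∧ IsingLimitAxisPermutation ∧
ExistsScaleCovariantLimit ∧ InversionUpgradeNormalised ∧ IsingEuclidUpgradeR4NonGaussian`

## Assembly
Pure logic (term proof in the planner's Sketch.lean, rc 0): take ρ, Δ, S from (C); (L) gives v and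
(a), (b); (M) gives c and Q_c-isotropy;
IsingLimitAxisPermutation gives the swap x₀ ↔ x₂; (V) with Δ > 0 from (C) gives IsRotationInvariant
S, hence IsEuclideanInvariant S;
(D) gives IsInversionCovariant Δ S, so IsMoebiusCovariant Δ S := ⟨Euclid, scale, inversion⟩; (E)
gives HasNontrivialU4 S; conclude
CritIsing3DConformalLimit = Ising3DConformalLimit.

Rationale: WHY THIS LINE. A Euclidean rotation mixing x₂ with x₀ is, after OS reconstruction along e₃, a
Lorentz boost; boost symmetry is the one spacetime symmetry
that Tomita–Takesaki theory manufactures from positivity: Borchers1992 (wedge algebra + positive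
lightlike generators ⇒ the modular group acts
on translations as boosts), BisognanoWichmann1975 / Haag1996 Thm V.4.1.1, BrunettiGuidoLongo1995 and
BuchholzEtAl2000 (modular covariance /
geometric modular action ⇒ a covariant positive-energy representation of the Poincaré group).
Imported area: algebraic QFT / von Neumann
modular theory, with the explicit dictionary rotation ↦ boost, lattice mirror ↦ OS time axis, axis
swap ↦ c = 1; the Ising-specific input is
the light cone (L), to be sourced from reflection positivity in the NINE mirror families of the n.n.
model (FrohlichIsraelLiebSimon1978) —
Glimm–Jaffe ch. 19 obtain exactly (a), (b) from the rotation axiom OS1, and this route inverts that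
logic. Versus the open routes: HyperoctahedralRP
bets on a two-point harmonic-analysis rigidity lemma (A) and needs a separate n-point step; here
isotropy of ALL S_n comes from one operator-
algebraic mechanism and no two-point lemma is used; IsingEuclidUpgrade/IsingCFTData postulate
rotations. Negatives index: only the SAW item 0772, unrelated.

RANKED CRUXES. #2 IsingLimitLightCone (crux) — (L) of the thesis (card item R1, sharpened): for
every normalised, non-degenerate, translation-invariant, scale-covariant pointwise limit S of
criticalCorr 3 there is ONE speed v > 0 with (a) causal slit-gluing in complex e₃-time for every
insertion moved inside a slab free of other insertion times (window |Im ζ| < ‖q‖/v, full strip |Re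
ζ| < R) and (b) the spectral cone H ≥ v|P_j|, j = 0, 1, as joint holomorphy of time-separated blocks
under complex time gap + complex spatial shift. Glimm–Jaffe Prop. 19.5.7 and Cor. 19.5.4/Thm 19.5.5
give (a), (b) at v = 1 FROM Euclidean rotations; here rotations are unavailable and the intended
source is RP in the nine lattice mirrors (three axes, six face diagonals) + one-variable
Stieltjes/Widder structure + separate-to-joint analyticity. [difficulty: XL] (why it might fail:
One-directional RP only gives the two half-strips; gluing across real times and complex spatial
shifts are tube statements in several variables with no Lorentz group to enlarge the domain (no
BHW), and (a),(b) must hold at a COMMON v: finitely many mirrors may leave an anisotropic,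
non-causal limit.) [GlimmJaffe1987, OsterwalderSchrader1973, OsterwalderSchrader1975,
FrohlichIsraelLiebSimon1978, DuminilCopinICM2022, DKKMO2020Rotational]
#3 ModularBoostIsotropy (crux) — (M) of the thesis (card items R2+R3 with Borchers/BGL): for every
such limit S and every v > 0 at which (a) and (b) hold, there is c > 0 such that S n (A x₁, …, A xₙ)
= S n (x) for all n and every linear A preserving x₀² + x₁² + c²x₂². Intended proof: OS-reconstruct
along e₃ (RP inherited from the lattice); (b) ⇒ H ≥ v|P_j| and Reeh–Schlieder, so Ω is standard for
the wedge algebras W_j = {x_j > v|t|} (separating from (a)); Borchers1992 ⇒ Δ_{W_j}^{it} acts on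
translations as speed-v boosts; wedge duality / modular covariance (the Bisognano–Wichmann property
without Lorentz input) ⇒ BrunettiGuidoLongo1995 covariant representation of the (2+1) Poincaré group
of speed v; σ, the edge field of lowest dimension, is modular-covariant; boost-invariant Wightman
functions continue back to SO(x₀²+x₁²+c²x₂²)-invariant Schwinger functions (c = v), reflections from
the lattice. [deps: IsingLimitLightCone] [difficulty: XL] (why it might fail: Modular groups of
translation-covariant wedge-local nets need not act geometrically (Yngvason1994); for massless d=3
generalized free fields wedge duality/CGMA ⇔ Lorentz covariance of the maximal net only
(GaierYngvason2000): an Ising-specific source of wedge duality is needed, none known.)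
[Borchers1992, BisognanoWichmann1975, Haag1996, BrunettiGuidoLongo1995, BrunettiGuidoLongo1993,
BuchholzEtAl2000, GaierYngvason2000, Yngvason1994]
#4 ExistsScaleCovariantLimit (crux) — (C): there are ρ > 0 on (0,1], Δ > 0 and S with
HasPointwiseScalingLimit (criticalCorr 3) ρ S, S = 0 off NonCoincident, IsNondegenerateTwoPoint S,
IsTranslationInvariant S, IsScaleCovariant Δ S — NO rotation clause (isotropy is output). Shared
verbatim with HyperoctahedralRP (stmt-CriticalPhenomena-1981). [difficulty: open-problem] (why it
might fail: Full δ→0⁺ convergence with ONE continuous Δ is open on ℤ³: only subsequential limits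
follow from the two-point bounds, and RP/GKS two-point axiomatics admit log-periodic (discretely
scale covariant) profiles.) [DuminilCopinICM2022, DuminilcopinPanis2025, arXiv:1912.07973,
AizenmanDuminilCopinAnnals2021]
#5 InversionUpgradeNormalised (crux) — (D): every normalised, non-degenerate, Euclidean-invariant,
scale-covariant pointwise limit of criticalCorr 3 is inversion covariant with the same Δ (the
upgrade (U) of route IsingEuclidUpgrade re-typed with the NonCoincident normalisation demanded by
Theorems/IsingEuclidUpgradeRefutations.lean). Shared verbatim with HyperoctahedralRP
(stmt-CriticalPhenomena-1982). [difficulty: open-problem] (why it might fail: Scale + RP + Euclid ⇏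
Möbius in general (free Maxwell d=3, ScaleCovarianceNotMoebius); for Ising it fails if the limit
carries a dimension-2 virial current or lacks a local stress tensor — excluded only numerically.)
[ElshowkNakayamaRychkov2011, Nakayama2015, DelamotteTissierWschebor2016, PolandRychkovVichi2019]
#6 IsingEuclidUpgradeR4NonGaussian (crux) — (E): every non-degenerate pointwise scaling limit of the
renormalised critical Ising correlators on ℤ³ has U₄ ≢ 0 on non-coincident configurations
(random-current intersection at macroscopic separation). Shared item stmt-CriticalPhenomena-0636.
[difficulty: open-problem] (why it might fail: No proof that U₄ ≢ 0 in d = 3: the double-current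
intersection probability at macroscopic separation must stay positive as δ → 0; RP long-range models
ON ℤ³ with α < 3/2 are Gaussian (LongRangeTrivialityOnZ3).) [AizenmanDuminilCopinAnnals2021,
DuminilCopinICM2022]
#9 EllipsoidToSphere (support) — (V), pure linear algebra: if S : CorrFamily 3 has positive
two-point function on NonCoincident, is scale covariant with Δ > 0, invariant under the coordinate
swap x₀ ↔ x₂ and under every linear map preserving Q_c = x₀² + x₁² + c²x₂² (c > 0), then
IsRotationInvariant S. For c = 1 immediate (linear isometries preserve Q_1 = ‖·‖²); for c ≠ 1 the
hypotheses are contradictory: with D = diag(1,1,c), A = D⁻¹R_{π/2}D (rotation in the (0,2)-plane)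
and its swap-conjugate B, tr(AB) on that plane is −(c² + c⁻²) < −2, so (AB)² has an eigenvector x
with eigenvalue μ ≠ 1, μ > 0; the pair (x, 2x) is non-coincident and S 2 (x,2x) = S 2 (μx, 2μx) =
μ^(−2Δ) S 2 (x,2x) forces S 2 (x,2x) = 0. [difficulty: provable-now] [Haag1996,
FrancescoMathieuSenechal1997]
#9 IsingLimitAxisPermutation (support) — (B₃, the part used): every normalised pointwise scaling
limit S of criticalCorr 3 is invariant under permutations of the coordinate axes
(LinearIsometryEquiv.piLpCongrLeft), all n: latticeApprox commutes exactly with coordinate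
permutations and criticalCorr 3 is invariant under lattice automorphisms
(IsingAutomorphismCovariance), so the rescaled correlators agree for every δ; off NonCoincident both
sides vanish. [difficulty: provable-now] [FriedliVelenik2017, GlimmJaffe1987]
#9 LimitRotationInvariance (support) — Milestone (the rotational half of crit-ising.S03, normalised,
ALL n): every normalised, non-degenerate, translation-invariant, scale-covariant pointwise limit of
criticalCorr 3 is O(3)-invariant. Follows from IsingLimitLightCone, ModularBoostIsotropy,
EllipsoidToSphere, IsingLimitAxisPermutation and Δ ≥ 1/2 (TwoPointKernelOfLimit of
HyperoctahedralRP) by the logic of the assembly (checked in Sketch.lean); it is also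
HyperoctahedralRP's crux (B) with hypothesis (A) discharged — the common milestone of both rotation
routes. [difficulty: open-problem] [DuminilCopinICM2022, DKKMO2020Rotational]

TWO-LAYER PLAN. IsingLimitLightCone ⇐ CausalGluingUnitSpeed → SpectralConeUnitSpeed →
IsingLimitLightCone (k = 2; the natural split fixes v = 1, the value
cubic symmetry predicts, and separates locality from the spectrum condition). ModularBoostIsotropy ⇐
WedgeStandardness (Ω cyclic and
separating for the e₀/e₁ wedge algebras of the e₃-reconstruction; Reeh–Schlieder from (b)) →
EdgeFieldModularCovariance (σ at the edge
commutes with Δ_W^it — the Bisognano–Wichmann property without Lorentz input; equivalently wedge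
duality) → ModularBoostIsotropy (k = 2–3),
filed once the definition requests below land (OS reconstruction data of a CorrFamily, wedge
algebra, Borchers/BGL as named facts).

KILL CRITERIA. A proof that some normalised scale-covariant Ising limit violates (a) or (b) at every
v (¬IsingLimitLightCone) closes the route
(`refuted:IsingLimitLightCone`) and is a barrier entry "lattice RP ⇏ emergent light cone". A
MODEL-BLIND counterexample — a translation-
invariant, nine-mirror-RP, B₃-symmetric, dilation-covariant, permutation-symmetric family with
(a)+(b) at some v but no ellipsoidal
isotropy (the two-speed generalized free field S₂ = Q_{c₁}^(−Δ) + Q_{c₂}^(−Δ) is the template, but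
it is not B₃/diagonal-RP) — does not refute
the Ising-specific items but kills the engine as model-blind: pivot ModularBoostIsotropy to an
explicit Ising source of wedge duality or
close `exhausted`. HRP2Rigidity (route HyperoctahedralRP) proved ⇒ the n = 2 case is settled there
and this route competes only on n ≥ 3;
LimitRotationInvariance proved by any route moots r2–r3 here. Refutation of (C), (D) or (E) kills
the conjunct for all routes alike.

NOT DECOMPOSED YET. The operator-algebraic layer of ModularBoostIsotropy (standardness, Borchers
commutation relations, wedge duality, BGL representation, field
identification of σ as the lowest-dimension odd edge field) — it needs definitions Lean lacks and is
layer 2; the passage lattice nine-mirror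
RP ⇒ OS positivity of the pointwise limit in nine directions (routine, shared with
HyperoctahedralRP's CriticalCorrNineMirrorRP); growth /
temperedness bounds of S_n near coincidences (Newman–Lebowitz Gaussian upper bounds) needed for OS
reconstruction; the v = 1 specialisation.

CHEAPEST FALSIFIER. Compute the modular data of the e₀-wedge for the two-speed generalized free
field (GaierYngvason2000 give the modular groups of wedge algebras
of non-Lorentz GFFs explicitly): it satisfies (a)+(b) at v = max(c₁,c₂)/min… only if c₁ = c₂ — check
whether ANY translation-invariant e₃-RP
family can have (a) and (b) at a common v without being Q_v-isotropic at n = 2 (one-variable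
Nevanlinna/Stieltjes computation on
S₂(q, ζ)); if yes, ModularBoostIsotropy is model-blind-false and the route must exhibit
Ising-specific duality at once. Lookup falsifier:
Jakóbczyk 1993 (doi:10.1016/0034-4877(93)90007-2, acq-02333) — if BW duality is derived there from
Euclidean data WITHOUT rotations, r3 drops to known.

NUMBERS. Δ_σ ∈ [1/2, 1] rigorously on ℤ³ (scalingDimension_mem_Icc_holds; infrared bound and MMS),
Δ_σ = 0.5181489(10) numerically (KosPolandSimmonsDuffinVichi2016);
expected v = c = 1 by cubic symmetry; 2D sanity check (card): the isotropic critical Ising transfer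
matrix has dispersion arccosh(2 − cos p)
with maximal group velocity exactly 1. Items at open: 9 (5 cruxes of which 3 shared, 3 support, 1
assembly).

DEFINITION REQUESTS. - OSReconstructionOfCorrFamily
(Literature/MathematicalPhysics/QuantumFieldTheory): Hilbert space, vacuum, contraction semigroup
e^(−tH) and
  spatial translations reconstructed from a pointwise CorrFamily 3 that is reflection positive in
direction e₂-index (finite sums over
  half-space configurations), with the sharp-time field as a bilinear form — the pointwise analogue
of the tree's OSData (which has Euclidean
  invariance as a FIELD and so cannot be used here).
- WedgeAlgebraStandard / named facts Borchers1992 (Thm II.1: half-sided translations with positive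
lightlike generators ⇒ Δ^it U(a) Δ^−it =
  U(Λ(−2πt)a)) and BrunettiGuidoLongo1995 (modular covariance ⇒ covariant unitary representation),
over Mathlib's VonNeumannAlgebra — Mathlib
  has no Tomita–Takesaki theory, so these enter as `def … : Prop` facts used as hypotheses.
- No new definition is needed for the nine items filed now (all elaborate over
Literature.Probability.LatticeModels + Mathlib).

Novelty: Searches (2026-08-15): `lit search --hybrid "Borchers CPT theorem two-dimensional … modular group
wedge translations half-sided"` (12 docs; held:
Haag1996 pp. 266–270 read: Thm V.4.1.1 + Remark 1 citing [Borch 92, 95]); `lit search --source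
crossref` ×4 (Borchers 1992 doi:10.1007/bf02099011;
Yngvason 1994 doi:10.1007/bf00750147; Gaier–Yngvason 2000 doi:10.1063/1.1286174, read pp. 1–3;
Bisognano–Wichmann 1975; BGL 1993/1995;
Jakóbczyk 1993 "Bisognano–Wichmann duality in Euclidean field theory", paywalled → acq-02333); `lit
vsearch "Lorentz boost symmetry of the
continuum limit of a lattice model derived from Tomita–Takesaki…"` (10 docs → GlimmJaffe1987 ch. 19
read: Thm 19.5.1, Cor 19.5.4, Thm 19.5.5,
Prop 19.5.7, Thm 19.6.1 — all from OS1); `lit galaxy search … --star all` ×2 (daemon saturated, 0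
rows, logged); openalex/arxiv rate-limited
(HTTP 429, logged); plus the card's own audit (galaxy intelligent, BDFS 2000, Wiesbrock, Thacker
1986).
Nearest prior art found: Borchers1992 + BrunettiGuidoLongo1995 + BuchholzEtAl2000 (spacetime
symmetry from modular data, locality and wedge
structure ASSUMED, Minkowski); GaierYngvason2000 (for GFFs: CGMA ⇔ wedge duality ⇔ Lorentz
covariance — the obstruction, not the application);
GlimmJaffe1987 §19.5–19.6 (slit analyticity and forward-cone spectrum derived from Euclidean
rotations); DKKMO2020Rotational (the only
rotation theorem for a non-Gaussian critical lattice model, planar, by integrability).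
Delta: states Euclidean rotation invarian  [refs: 10.1007/bf02099011, 10.1007/bf00750147, 10.1063/1.1286174, doi:10.1007/bf02099011, doi:10.1007/bf00750147, doi:10.1063/1.1286174, Haag1996, GlimmJaffe1987, Borchers1992, BrunettiGuidoLongo1995, BuchholzEtAl2000, GaierYngvason2000]

Barriers (technique_class: modular-boosts, multi-mirror-rp, wedge-locality): - technique_class: modular-boosts, multi-mirror-rp, wedge-locality
- Literature.Barriers.CriticalPhenomena.ScaleCovarianceNotMoebius: not engaged by r2–r3 (they
produce the ROTATION data, not the inversion, and keep HasPointwiseScalingLimit (criticalCorr 3)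
among the hypotheses, outside the class EuclideanScaleUpgrade); r5 is typed with the NonCoincident
normalisation exactly as Theorems/IsingEuclidUpgradeRefutations.lean prescribes.
- Literature.Barriers.CriticalPhenomena.LiouvilleRigidity: respected — no conformal maps, discrete
holomorphicity or SLE; the symmetry enhancement is SO(2,1)-boost covariance from modular theory, a
finite-dimensional group, consistent with d = 3 rigidity.
- Literature.Barriers.CriticalPhenomena.BootstrapLatticeBlindness: evaded — nothing is inferred from
CFT data; the lattice enters through nine-mirror RP (destroyed by a next-nearest-neighbour bond
across x₀ = x₁) and the exact axis swap; conceded: Borchers/BGL are model-blind theorems and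
GaierYngvason2000 shows the engine needs a model-specific duality input.
- Literature.Barriers.CriticalPhenomena.LongRangeTrivialityOnZ3: its RP long-range witnesses (J =
g(‖x‖₁)) are reflection positive in the coordinate mirrors only; they bear on r6 (shared) exactly as
for every route and not on r2–r3.
- Literature.Barriers.CriticalPhenomena.RigorousRGSmallParameter and PositionSpaceRGNonGibbsian: not
used (no RG map, no small parameter).
- Negatives index: one refuted statement in the summit (stmt-CriticalPh

History (route lifecycle, newest last):
- 2026-08-25T16:03:04Z · DORMANT — reconciler: no traction for 7.8 d (last activity item-evidence-added at 2026-08-17T19:18:53Z); parked, not closed — `ledger route dormant route-CriticalPhenomen (operator:999:2408001)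
- 2026-08-27T13:27:25Z · REACTIVATED — reconciler: reactivated — activity statement-claimed at 2026-08-27T11:07:20Z after parking at 2026-08-25T16:03:04Z (operator:999:2433053)
- 2026-08-29T19:31:26Z · DORMANT — census g0: costume|duplicate of route-CriticalPhenomena-HyperoctahedralRP; reader census-reader-35-g0 (operator:999:1136591)

sub-problem: Ising3DConformalLimit · status: dormant · opened planner-plancard-CriticalPhenomena-Ising3DCon-01a372de-0 2026-08-15T11:41:07Z · rev 4 · ledger route-CriticalPhenomena-ModularBoosts
GENERATED by the gate from the ledger (D-0016/17). Provers cite these decls: `theorem foo : Summit.CriticalPhenomena.Ising3DConformalLimit.Theses.ModularBoosts.<Decl> := …` in Summits/CriticalPhenomena/Ising3DConformalLimit/Theorems/<Name>.lean.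
-/

namespace Summit.CriticalPhenomena.Ising3DConformalLimit.Theses.ModularBoosts

open scoped BigOperators Topology Manifold Classical MeasureTheory ProbabilityTheory Matrix InnerProductSpace ComplexConjugate ContinuousMap
open Filter Set Function TopologicalSpace MeasureTheory

attribute [summit_statement] _root_.Ising3DConformalLimit

/-- item stmt-CriticalPhenomena-5430 · crux · rank 2 · open · by planner
why it might fail: One-directional RP only gives the two half-strips; gluing across real times and complex spatial shifts are tube statements in several variables with no Lorentz group to enlarge the domain (no BHW), and (a),(b) must hold at a COMMON v: finitely many mirrors may leave an anisotropic, non-causal limit.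
sources: GlimmJaffe1987, OsterwalderSchrader1973, OsterwalderSchrader1975, FrohlichIsraelLiebSimon1978, DuminilCopinICM2022, DKKMO2020Rotational
[crux] (L) of the thesis (card item R1, sharpened): for every normalised, non-degenerate,
translation-invariant, scale-covariant pointwise limit S of criticalCorr 3 there is ONE speed v > 0
with (a) causal slit-gluing in complex e₃-time for every insertion moved inside a slab free of other
insertion times (window |Im ζ| < ‖q‖/v, full strip |Re ζ| < R) and (b) the spectral cone H ≥ v|P_j|,
j = 0, 1, as joint holomorphy of time-separated blocks under complex time gap + complex spatial
shift. Glimm–Jaffe Prop. 19.5.7 and Cor. 19.5.4/Thm 19.5.5 give (a), (b) at v = 1 FROM Euclidean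
rotations; here rotations are unavailable and the intended source is RP in the nine lattice mirrors
(three axes, six face diagonals) + one-variable Stieltjes/Widder structure + separate-to-joint
analyticity. [difficulty: XL] -/
@[route_item "route-CriticalPhenomena-ModularBoosts", crux]
def IsingLimitLightCone : Prop :=
  ∀ (ρ : ℝ → ℝ) (Δ : ℝ) (S : Literature.Probability.LatticeModels.CorrFamily 3), (∀ δ ∈ Set.Ioc (0:ℝ) 1, 0 < ρ δ) → Literature.Probability.LatticeModels.HasPointwiseScalingLimit (Literature.Probability.LatticeModels.criticalCorr 3) ρ S → (∀ n z, z ∉ Literature.Probability.LatticeModels.NonCoincident 3 n → S n z = 0) → Literature.Probability.LatticeModels.IsNondegenerateTwoPoint S → Literature.Probability.LatticeModels.IsTranslationInvariant S → Literature.Probability.LatticeModels.IsScaleCovariant Δ S → ∃ v : ℝ, 0 < v ∧ (∀ (n : ℕ) (p q : EuclideanSpace ℝ (Fin 3)) (x : Fin n → EuclideanSpace ℝ (Fin 3)) (R : ℝ), 0 < R → q ≠ 0 → q 2 = 0 → (∀ i, R < |x i 2 - p 2|) → Matrix.vecCons (p + q) (Matrix.vecCons p x) ∈ Literature.Probability.LatticeModels.NonCoincident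 3 (n + 1 + 1) → ∃ Φ : ℂ → ℂ, DifferentiableOn ℂ Φ {ζ : ℂ | |ζ.re| < R ∧ (ζ.re ≠ 0 ∨ |ζ.im| < ‖q‖ / v)} ∧ ∀ s : ℝ, |s| < R → Φ (s : ℂ) = (S (n + 1 + 1) (Matrix.vecCons (p + q + s • EuclideanSpace.single 2 (1:ℝ)) (Matrix.vecCons p x)) : ℂ)) ∧ (∀ (m k : ℕ) (x : Fin m → EuclideanSpace ℝ (Fin 3)) (y : Fin k → EuclideanSpace ℝ (Fin 3)) (g : ℝ) (j : Fin 3), j ≠ 2 → 0 < g → (∀ a b, x a 2 + g ≤ y b 2) → Fin.append x y ∈ Literature.Probability.LatticeModels.NonCoincident 3 (m + k) → ∃ Φ : ℂ × ℂ → ℂ, DifferentiableOn ℂ Φ {w : ℂ × ℂ | -g < w.1.re ∧ |w.2.im| < v * (w.1.re + g)} ∧ ∀ s b : ℝ, -g < s → Φ ((s : ℂ), (b : ℂ)) = (S (m + k) (Fin.append x (fun i => y i + s • EuclideanSpace.single 2 (1:ℝ) + b • EuclideanSpace.single j (1:ℝ))) : ℂ))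

/-- item stmt-CriticalPhenomena-5431 · crux · rank 3 · open · by planner
why it might fail: Wedge modular groups of translation-covariant local nets need not act geometrically (Yngvason1994); for d=3 GFFs modular action ⇔ wedge duality ⇔ Lorentz covariance (GaierYngvason2000); even Poincaré nets can fail BW (Morinelli 2018): an Ising-specific source of wedge duality is needed; none known.
sources: GaierYngvason2000, Yngvason1994, doi:10.1007/s00023-017-0636-4, Borchers1992, BrunettiGuidoLongo1995, BisognanoWichmann1975
[crux] (M) of the thesis (card items R2+R3 with Borchers/BGL): for every such limit S and every v >
0 at which (a) and (b) hold, there is c > 0 such that S n (A x₁, …, A xₙ) = S n (x) for all n and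
every linear A preserving x₀² + x₁² + c²x₂². Intended proof: OS-reconstruct along e₃ (RP inherited
from the lattice); (b) ⇒ H ≥ v|P_j| and Reeh–Schlieder, so Ω is standard for the wedge algebras W_j
= {x_j > v|t|} (separating from (a)); Borchers1992 ⇒ Δ_{W_j}^{it} acts on translations as speed-v
boosts; wedge duality / modular covariance (the Bisognano–Wichmann property without Lorentz input) ⇒
BrunettiGuidoLongo1995 covariant representation of the (2+1) Poincaré group of speed v; σ, the edge
field of lowest dimension, is modular-covariant; boost-invariant Wightman functions continue back to
SO(x₀²+x₁²+c²x₂²)-invariant Schwinger functions (c = v), reflections from the lattice. [deps: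
IsingLimitLightCone] [difficulty: XL] -/
@[route_item "route-CriticalPhenomena-ModularBoosts", crux]
def ModularBoostIsotropy : Prop :=
  ∀ (ρ : ℝ → ℝ) (Δ v : ℝ) (S : Literature.Probability.LatticeModels.CorrFamily 3), (∀ δ ∈ Set.Ioc (0:ℝ) 1, 0 < ρ δ) → Literature.Probability.LatticeModels.HasPointwiseScalingLimit (Literature.Probability.LatticeModels.criticalCorr 3) ρ S → (∀ n z, z ∉ Literature.Probability.LatticeModels.NonCoincident 3 n → S n z = 0) → Literature.Probability.LatticeModels.IsNondegenerateTwoPoint S → Literature.Probability.LatticeModels.IsTranslationInvariant S → Literature.Probability.LatticeModels.IsScaleCovariant Δ S → 0 < v → (∀ (n : ℕ) (p q : EuclideanSpace ℝ (Fin 3)) (x : Fin n → EuclideanSpace ℝ (Fin 3)) (R : ℝ), 0 < R → q ≠ 0 → q 2 = 0 → (∀ i, R < |x i 2 - p 2|) → Matrix.vecCons (p + q) (Matrix.vecCons p x) ∈ Literature.Probability.LatticeModels.NonCoincident 3 (n + 1 + 1) → ∃ Φ : ℂ → ℂ, DifferentiableOn ℂ Φ {ζ : ℂ | |ζ.re|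 < R ∧ (ζ.re ≠ 0 ∨ |ζ.im| < ‖q‖ / v)} ∧ ∀ s : ℝ, |s| < R → Φ (s : ℂ) = (S (n + 1 + 1) (Matrix.vecCons (p + q + s • EuclideanSpace.single 2 (1:ℝ)) (Matrix.vecCons p x)) : ℂ)) → (∀ (m k : ℕ) (x : Fin m → EuclideanSpace ℝ (Fin 3)) (y : Fin k → EuclideanSpace ℝ (Fin 3)) (g : ℝ) (j : Fin 3), j ≠ 2 → 0 < g → (∀ a b, x a 2 + g ≤ y b 2) → Fin.append x y ∈ Literature.Probability.LatticeModels.NonCoincident 3 (m + k) → ∃ Φ : ℂ × ℂ → ℂ, DifferentiableOn ℂ Φ {w : ℂ × ℂ | -g < w.1.re ∧ |w.2.im| < v * (w.1.re + g)} ∧ ∀ s b : ℝ, -g < s → Φ ((s : ℂ), (b : ℂ)) = (S (m + k) (Fin.append x (fun i => y i + s • EuclideanSpace.single 2 (1:ℝ) + b • EuclideanSpace.single j (1:ℝ))) : ℂ)) → ∃ c : ℝ, 0 < c ∧ ∀ (n : ℕ) (A : EuclideanSpace ℝ (Fin 3) →ₗ[ℝ] EuclideanSpace ℝ (Fin 3)),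 (∀ z : EuclideanSpace ℝ (Fin 3), (A z) 0 ^ 2 + (A z) 1 ^ 2 + c ^ 2 * (A z) 2 ^ 2 = z 0 ^ 2 + z 1 ^ 2 + c ^ 2 * z 2 ^ 2) → ∀ x : Fin n → EuclideanSpace ℝ (Fin 3), S n (fun i => A (x i)) = S n x

/-- item stmt-CriticalPhenomena-1981 · crux · rank 4 · SPLIT (gen 2) into TwoPointDoubling, ClusterSetTotallyDisconnected + glue Summit.CriticalPhenomena.Ising3DConformalLimit.Cruxes.ExistsScaleCovariantLimit.SplitGlue.hrp_crux_of_doubling_of_totallyDisconnected · direct attempts still welcome (low priority) · by planner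
why it might fail: Full δ→0⁺ convergence with ONE continuous Δ is open on ℤ³: only subsequential limits follow from the two-point bounds, and RP/GKS two-point axiomatics admit log-periodic (discretely scale covariant) profiles.
sources: DuminilCopinICM2022, DuminilcopinPanis2025, arXiv:1912.07973, AizenmanDuminilCopinAnnals2021
earlier split gen 1: TwoPointDoubling, ClusterSetTotallyDisconnected — retired stmt-CriticalPhenomena-4659, stmt-CriticalPhenomena-6150
[crux r4, (C), existence WITHOUT rotations] There are ρ > 0 on (0,1], Δ > 0 and S with
HasPointwiseScalingLimit (criticalCorr 3) ρ S, S = 0 off NonCoincident, IsNondegenerateTwoPoint S,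
IsTranslationInvariant S, IsScaleCovariant Δ S. Strictly weaker than CritIsing3DEuclideanLimit (item
0638: rotations included) — on this route isotropy is OUTPUT. Inputs in tree:
criticalTwoPoint_bounds_holds (c|x|⁻² ≤ G ≤ C|x|⁻¹ ⇒ subsequential limits, Δ ∈ [1/2,1]); missing:
uniqueness/full-filter convergence and continuous scale covariance (DuminilCopinICM2022 §8.4 p.29:
'widely open'). -/
@[route_item "route-CriticalPhenomena-ModularBoosts", crux]
def ExistsScaleCovariantLimit : Prop :=
  ∃ (ρ : ℝ → ℝ) (Δ : ℝ) (S : Literature.Probability.LatticeModels.CorrFamily 3), (∀ δ ∈ Set.Ioc (0:ℝ) 1, 0 < ρ δ) ∧ 0 < Δ ∧ Literature.Probability.LatticeModels.HasPointwiseScalingLimit (Literature.Probability.LatticeModels.criticalCorr 3) ρ S ∧ (∀ n z, z ∉ Literature.Probability.LatticeModels.NonCoincident 3 n → S n z = 0) ∧ Literature.Probability.LatticeModels.IsNondegenerateTwoPoint S ∧ Literature.Probability.LatticeModels.IsTranslationInvariant S ∧ Literature.Probability.LatticeModels.IsScaleCovariant Δ S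

-- parent: ExistsScaleCovariantLimit · child (gen 2)
/--     item stmt-CriticalPhenomena-6150 · crux · rank 401 · open
    parent: ExistsScaleCovariantLimit · by planner
    why it might fail: Open in print (ADC21 Rem 5.10, §5.6): RP/MMS/IR/sliding-scale IR/DCP24 Thm 1.3 admit completely monotone crossover profiles c n^{-3/2}+Ce^{-n/N}/n losing doubling by N^{-1/4}; only √n-doubling (p146786) and positive-density regular scales are proved.
    sources: AizenmanDuminilCopinAnnals2021, arXiv:1912.07973, arXiv:2404.05700, arXiv:2509.02850, DuminilCopinICM2022, Literature.Probability.LatticeModels.criticalTwoPoint_bounds_holds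
[crux] (D) ALL-SCALE DOUBLING of the axial critical two-point function on ℤ³: there is κ > 0 with
g(2n) ≥ κ·g(n) for all n ≥ 1, g(n) := ⟨σ₀σ_{n e₁}⟩⁺_{β_c(3)} (card item M3; = D1 of card
every-scale-regular-multiplicative-fekete). With MMS it gives G(z′) ≍ G(z) for ‖z′‖ ≍ ‖z‖ in all
directions; it is the one open LATTICE input of the compactness half and is filed first (the import
cone of everything below is otherwise proved: criticalTwoPoint_bounds_holds,
messager_miracleSole_holds, RP lemmas). [difficulty: open-problem] -/
@[route_item "route-CriticalPhenomena-ModularBoosts", crux]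
def TwoPointDoubling : Prop :=
  ∃ κ : ℝ, 0 < κ ∧ ∀ n : ℕ, 1 ≤ n → κ * Literature.Probability.LatticeModels.criticalTwoPoint 3 (Pi.single 0 (n : ℤ)) ≤ Literature.Probability.LatticeModels.criticalTwoPoint 3 (Pi.single 0 (2 * (n : ℤ)))

-- parent: ExistsScaleCovariantLimit · child (gen 2)
/--     item stmt-CriticalPhenomena-4659 · crux · rank 402 · open
    parent: ExistsScaleCovariantLimit · by planner
    why it might fail: Fails if Δ drifts (slowly varying g ⇒ an arc of pure-power cluster points), if 3D Ising sits on a conformal manifold (an exactly marginal even scalar; numerics Δ_{ε'}≈3.83 say no), or if cluster points evade locality; isolation of local CFTs is an expectation, not a theorem (Rychkov 2020 p.8).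
    sources: Rychkov2020, arXiv:2007.14315, PolandRychkovVichi2019, DuminilCopinICM2022, arXiv:1805.04405, Literature.Probability.LatticeModels.PointwiseScalingLimitDiscreteScaleInvariance
[crux] the cluster set 𝒞 of the self-normalised family is totally disconnected in the pointwise
(product) topology of CorrFamily 3 (on 𝒞, compact under Reg, this coincides with the locally uniform
topology; pointwise is the stronger ask otherwise). INTENDED ENGINE (card items (2)–(4), the route's
point, layer 2): 𝒞 ⊆ 𝓘 := σ-correlator families of LOCAL unitary ℤ₂-symmetric 3D CFTs with exactly
one relevant odd and exactly one relevant non-identity even scalar and Δ_σ ≤ 1 (lattice side: OS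
positivity, clustering, covariance and spectrum of cluster points), and 𝓘 is totally disconnected
(CFT side, lattice-blind: 'It is expected that most local CFTs are isolated. One exception are CFTs
with exactly marginal fields of dimension Δ = d … A folk conjecture says that exactly marginal
fields in d ≥ 3 require supersymmetry' — Rychkov2020, arXiv:2007.14315 p.8, read this session; LOCAL
= 'critical points of lattice models with finite-range interactions', ibid., which is what excludes
the non-local long-range arc; an ANALYTIC isolation theorem for exact solutions of crossing — NOT a
finite-Λ positivity certificate, which only gives diam ≤ ε(Λ): refuter flag on the card, accepted).
Both halves -/
@[route_item "route-CriticalPhenomena-ModularBoosts", crux]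
def ClusterSetTotallyDisconnected : Prop :=
  IsTotallyDisconnected {S : Literature.Probability.LatticeModels.CorrFamily 3 | (∀ n x, x ∉ Literature.Probability.LatticeModels.NonCoincident 3 n → S n x = 0) ∧ ∃ u : ℕ → ℝ, (∀ k, u k ∈ Set.Ioc (0:ℝ) 1) ∧ Filter.Tendsto u Filter.atTop (nhds 0) ∧ ∀ n, TendstoLocallyUniformlyOn (fun k => Literature.Probability.LatticeModels.rescaledCorrelator (Literature.Probability.LatticeModels.criticalCorr 3) (fun δ : ℝ => (Literature.Probability.LatticeModels.criticalTwoPoint 3 (Pi.single 0 ⌊δ⁻¹⌋)) ^ (-(1/2:ℝ))) n (u k)) (S n) Filter.atTop (Literature.Probability.LatticeModels.NonCoincident 3 n)}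

/-- glue for the split of `ExistsScaleCovariantLimit`: landed theorem `Summit.CriticalPhenomena.Ising3DConformalLimit.Cruxes.ExistsScaleCovariantLimit.SplitGlue.hrp_crux_of_doubling_of_totallyDisconnected`. -/
theorem ExistsScaleCovariantLimitGlueBy_holds : TwoPointDoubling → ClusterSetTotallyDisconnected → ExistsScaleCovariantLimit := _root_.Summit.CriticalPhenomena.Ising3DConformalLimit.Cruxes.ExistsScaleCovariantLimit.SplitGlue.hrp_crux_of_doubling_of_totallyDisconnected

/-- item stmt-CriticalPhenomena-1982 · crux · rank 5 · open · by planner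
why it might fail: Scale + RP + Euclid ⇏ Möbius in general (free Maxwell d=3, ScaleCovarianceNotMoebius); for Ising it fails if the limit carries a dimension-2 virial current or lacks a local stress tensor — excluded only numerically.
sources: ElshowkNakayamaRychkov2011, Nakayama2015, DelamotteTissierWschebor2016, PolandRychkovVichi2019
[crux r5, (D), inversion upgrade re-typed] Every pointwise scaling limit S of criticalCorr 3 (ρ > 0
on (0,1]) that is normalised (S = 0 off NonCoincident), non-degenerate, Euclidean invariant and
scale covariant with Δ is IsInversionCovariant Δ (hence Möbius). This is (U) of route
IsingEuclidUpgrade (item 0637, refuted AS TYPED by not_inversionUpgrade_of_euclideanLimit through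
values on the coincident locus) with the normalisation hypothesis the refutation file prescribes;
the model-blind version is false (Literature.Barriers.CriticalPhenomena.ScaleCovarianceNotMoebius;
free Maxwell d=3, ElshowkNakayamaRychkov2011), so any proof must use the Ising hypothesis (RP +
locality / absence of a dimension-2 virial current: DelamotteTissierWschebor2016 §5–6,
Nakayama2015). -/
@[route_item "route-CriticalPhenomena-ModularBoosts", crux]
def InversionUpgradeNormalised : Prop :=
  ∀ (ρ : ℝ → ℝ) (Δ : ℝ) (S : Literature.Probability.LatticeModels.CorrFamily 3), (∀ δ ∈ Set.Ioc (0:ℝ) 1, 0 < ρ δ) → Literature.Probability.LatticeModels.HasPointwiseScalingLimit (Literature.Probability.LatticeModels.criticalCorr 3) ρ S → (∀ n z, z ∉ Literature.Probability.LatticeModels.NonCoincident 3 n → S n z = 0) → Literature.Probability.LatticeModels.IsNondegenerateTwoPoint S → Literature.Probability.LatticeModels.IsEuclideanInvariant S → Literature.Probability.LatticeModels.IsScaleCovariant Δ S → Literature.Probability.LatticeModels.IsInversionCovariant Δ S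

/-- item stmt-CriticalPhenomena-0636 · crux · rank 6 · open · by planner
why it might fail: No proof that U₄ ≢ 0 in d = 3: the double-current intersection probability at macroscopic separation must stay positive as δ → 0; RP long-range models ON ℤ³ with α < 3/2 are Gaussian (LongRangeTrivialityOnZ3).
sources: AizenmanDuminilCopinAnnals2021, DuminilCopinICM2022, Aizenman1982
Crux r4 (non-triviality in d=3): every non-degenerate pointwise scaling limit S of the renormalised
critical Ising correlators on Z^3 has connected four-point function U4 ≢ 0 on non-coincident
configurations. Intended tool: the random-current identity U4(x,y,z,t) =
−2⟨σxσy⟩⟨σzσt⟩·P^{xy,zt}[C_{n1+n2}(x) ∩ C_{n1+n2}(z) ≠ ∅] (Aizenman 1982; ADC2021 arXiv:1912.07973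
eq. (3.11)): non-Gaussianity ⇔ the intersection probability of the two double-current clusters at
macroscopic separation does not vanish as δ → 0. Contrast: for d ≥ 4 every such limit IS Gaussian
(Literature.Probability.LatticeModels.highDim_triviality). Its negation refutes the conjunct
Ising3DConformalLimit itself. -/
@[route_item "route-CriticalPhenomena-ModularBoosts", crux]
def IsingEuclidUpgradeR4NonGaussian : Prop :=
  ∀ (ρ : ℝ → ℝ) (S : Literature.Probability.LatticeModels.CorrFamily 3), (∀ δ ∈ Set.Ioc (0:ℝ) 1, 0 < ρ δ) → Literature.Probability.LatticeModels.HasPointwiseScalingLimit (Literature.Probability.LatticeModels.criticalCorr 3) ρ S → Literature.Probability.LatticeModels.IsNondegenerateTwoPoint S → Literature.Probability.LatticeModels.HasNontrivialU4 S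

/-- item stmt-CriticalPhenomena-5432 · support · rank 9 · closed · proved by Summit.CriticalPhenomena.Ising3DConformalLimit.ModularBoostsSpeed.ellipsoidToSphere_proof @ 9a48f4541aec (prover) · by planner
sources: Haag1996, FrancescoMathieuSenechal1997
[support] (V), pure linear algebra: if S : CorrFamily 3 has positive two-point function on
NonCoincident, is scale covariant with Δ > 0, invariant under the coordinate swap x₀ ↔ x₂ and under
every linear map preserving Q_c = x₀² + x₁² + c²x₂² (c > 0), then IsRotationInvariant S. For c = 1
immediate (linear isometries preserve Q_1 = ‖·‖²); for c ≠ 1 the hypotheses are contradictory: with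
D = diag(1,1,c), A = D⁻¹R_{π/2}D (rotation in the (0,2)-plane) and its swap-conjugate B, tr(AB) on
that plane is −(c² + c⁻²) < −2, so (AB)² has an eigenvector x with eigenvalue μ ≠ 1, μ > 0; the pair
(x, 2x) is non-coincident and S 2 (x,2x) = S 2 (μx, 2μx) = μ^(−2Δ) S 2 (x,2x) forces S 2 (x,2x) = 0.
[difficulty: provable-now] -/
@[route_item "route-CriticalPhenomena-ModularBoosts", crux]
def EllipsoidToSphere : Prop :=
  ∀ (Δ v : ℝ) (S : Literature.Probability.LatticeModels.CorrFamily 3), 0 < Δ → 0 < v → Literature.Probability.LatticeModels.IsNondegenerateTwoPoint S → Literature.Probability.LatticeModels.IsScaleCovariant Δ S → (∀ (n : ℕ) (x : Fin n → EuclideanSpace ℝ (Fin 3)), S n (fun i => LinearIsometryEquiv.piLpCongrLeft 2 ℝ ℝ (Equiv.swap (0 : Fin 3) 2) (x i)) = S n x) → (∀ (n : ℕ) (A : EuclideanSpace ℝ (Fin 3) →ₗ[ℝ] EuclideanSpace ℝ (Fin 3)), (∀ z : EuclideanSpace ℝ (Fin 3), (A z) 0 ^ 2 + (A z) 1 ^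 2 + v ^ 2 * (A z) 2 ^ 2 = z 0 ^ 2 + z 1 ^ 2 + v ^ 2 * z 2 ^ 2) → ∀ x : Fin n → EuclideanSpace ℝ (Fin 3), S n (fun i => A (x i)) = S n x) → Literature.Probability.LatticeModels.IsRotationInvariant S

-- `EllipsoidToSphere` holds: proved by `Summit.CriticalPhenomena.Ising3DConformalLimit.ModularBoostsSpeed.ellipsoidToSphere_proof` @ 9a48f4541aec (its module imports this route file, so no `_holds` link can be stated here).

/-- item stmt-CriticalPhenomena-5433 · support · rank 9 · closed · proved by Summit.CriticalPhenomena.Ising3DConformalLimit.Theorems.isingLimitAxisPermutation_proof @ d8ffd23b2405 (prover) · by planner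
sources: FriedliVelenik2017, GlimmJaffe1987
[support] (B₃, the part used): every normalised pointwise scaling limit S of criticalCorr 3 is
invariant under permutations of the coordinate axes (LinearIsometryEquiv.piLpCongrLeft), all n:
latticeApprox commutes exactly with coordinate permutations and criticalCorr 3 is invariant under
lattice automorphisms (IsingAutomorphismCovariance), so the rescaled correlators agree for every δ;
off NonCoincident both sides vanish. [difficulty: provable-now] -/
@[route_item "route-CriticalPhenomena-ModularBoosts", crux]
def IsingLimitAxisPermutation : Prop :=
  ∀ (ρ : ℝ → ℝ) (S : Literature.Probability.LatticeModels.CorrFamily 3), (∀ δ ∈ Set.Ioc (0:ℝ) 1, 0 < ρ δ) → Literature.Probability.LatticeModels.HasPointwiseScalingLimit (Literature.Probability.LatticeModels.criticalCorr 3) ρ S → (∀ n z, z ∉ Literature.Probability.LatticeModels.NonCoincident 3 n → S n z = 0) → ∀ (σ : Equiv.Perm (Fin 3)) (n : ℕ) (x : Fin n → EuclideanSpace ℝ (Fin 3)), S n (fun i => LinearIsometryEquiv.piLpCongrLeft 2 ℝ ℝ σ (x i)) = S n x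

-- `IsingLimitAxisPermutation` holds: proved by `Summit.CriticalPhenomena.Ising3DConformalLimit.Theorems.isingLimitAxisPermutation_proof` @ d8ffd23b2405 (its module imports this route file, so no `_holds` link can be stated here).

/-- item stmt-CriticalPhenomena-5434 · support · rank 9 · open · by planner
sources: DuminilCopinICM2022, DKKMO2020Rotational
[support] Milestone (the rotational half of crit-ising.S03, normalised, ALL n): every normalised,
non-degenerate, translation-invariant, scale-covariant pointwise limit of criticalCorr 3 is
O(3)-invariant. Follows from IsingLimitLightCone, ModularBoostIsotropy, EllipsoidToSphere,
IsingLimitAxisPermutation and Δ ≥ 1/2 (TwoPointKernelOfLimit of HyperoctahedralRP) by the logic of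
the assembly (checked in Sketch.lean); it is also HyperoctahedralRP's crux (B) with hypothesis (A)
discharged — the common milestone of both rotation routes. [difficulty: open-problem] -/
@[route_item "route-CriticalPhenomena-ModularBoosts"]
def LimitRotationInvariance : Prop :=
  ∀ (ρ : ℝ → ℝ) (Δ : ℝ) (S : Literature.Probability.LatticeModels.CorrFamily 3), (∀ δ ∈ Set.Ioc (0:ℝ) 1, 0 < ρ δ) → Literature.Probability.LatticeModels.HasPointwiseScalingLimit (Literature.Probability.LatticeModels.criticalCorr 3) ρ S → (∀ n z, z ∉ Literature.Probability.LatticeModels.NonCoincident 3 n → S n z = 0) → Literature.Probability.LatticeModels.IsNondegenerateTwoPoint S → Literature.Probability.LatticeModels.IsTranslationInvariant S → Literature.Probability.LatticeModels.IsScaleCovariant Δ S → Literature.Probability.LatticeModels.IsRotationInvariant S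

/-- item stmt-CriticalPhenomena-5435 · assembly · rank 1 · closed · proved by Summit.CriticalPhenomena.Ising3DConformalLimit.Theorems.modularBoosts_assembly_proof (prover) · by planner
sources: DuminilCopinICM2022, GlimmJaffe1987
[assembly] IsingLimitLightCone → ModularBoostIsotropy → EllipsoidToSphere →
IsingLimitAxisPermutation → ExistsScaleCovariantLimit → InversionUpgradeNormalised →
IsingEuclidUpgradeR4NonGaussian → Ising3DConformalLimit. -/
@[route_item "route-CriticalPhenomena-ModularBoosts"]
def Assembly : Prop :=
  IsingLimitLightCone → ModularBoostIsotropy → EllipsoidToSphere → IsingLimitAxisPermutation → ExistsScaleCovariantLimit → InversionUpgradeNormalised → IsingEuclidUpgradeR4NonGaussian → Ising3DConformalLimit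

-- `Assembly` holds: proved by `Summit.CriticalPhenomena.Ising3DConformalLimit.Theorems.modularBoosts_assembly_proof` (its module imports this route file, so no `_holds` link can be stated here).

/-! D-0027 §2.1 — DECIDING THEOREM (planner-authored via `route open/edit --closes-file`; by planner-rrepair-CriticalPhenomena-ModularBoost-85dda5fa-g2-0 2026-08-15T16:56:33Z):
its hypotheses are this route's items and its conclusion the sub-problem Statement (glue_lint), and it elaborates with this file. -/

@[closes "route-CriticalPhenomena-ModularBoosts"] theorem closes (hL : IsingLimitLightCone) (hM : ModularBoostIsotropy) (hC : ExistsScaleCovariantLimit)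
    (hD : InversionUpgradeNormalised) (hE : IsingEuclidUpgradeR4NonGaussian) (hV : EllipsoidToSphere)
    (hB : IsingLimitAxisPermutation) : _root_.Ising3DConformalLimit := by
  -- (C): a normalised, non-degenerate, translation-invariant, scale-covariant limit S with Δ > 0
  obtain ⟨ρ, Δ, S, hρ, hΔ, hlim, hnorm, hnd, htr, hsc⟩ := hC
  -- (L): one speed v with causal slit-gluing (a) and the spectral cone (b)
  obtain ⟨v, hv, ha, hb⟩ := hL ρ Δ S hρ hlim hnorm hnd htr hsc
  -- (M): ellipsoidal isotropy for some c > 0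
  obtain ⟨c, hc, hiso⟩ := hM ρ Δ v S hρ hlim hnorm hnd htr hsc hv ha hb
  -- (B₃): the axis swap x₀ ↔ x₂ passes to the limit
  have hswap := hB ρ S hρ hlim hnorm (Equiv.swap (0 : Fin 3) 2)
  -- (V): ellipsoid + swap + scale covariance + positivity ⇒ O(3)
  have hrot : Literature.Probability.LatticeModels.IsRotationInvariant S :=
    hV Δ c S hΔ hc hnd hsc hswap hiso
  have heuc : Literature.Probability.LatticeModels.IsEuclideanInvariant S := ⟨htr, hrot⟩
  -- (D): inversion upgrade with the same Δ
  have hinv : Literature.Probability.LatticeModels.IsInversionCovariant Δ S :=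
    hD ρ Δ S hρ hlim hnorm hnd heuc hsc
  -- (E): U₄ ≢ 0; assemble CritIsing3DConformalLimit (= Ising3DConformalLimit by `abbrev`)
  exact ⟨ρ, Δ, S, hρ, hΔ, hlim, hnd, ⟨heuc, hsc, hinv⟩, hE ρ S hρ hlim hnd⟩

end Summit.CriticalPhenomena.Ising3DConformalLimit.Theses.ModularBoosts
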